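import Literature.MathematicalPhysics.QuantumFieldTheory.Balaban1983to89.Beta.PolarizationSign

/-!
# `Balaban1983to89.Beta.OddMoments` — the PARITY-ODD part of the zero-momentum jet of a vacuum-polarization kernel
# vanishes: TWO independent printed routes (the Ward identity (5.9); the reflection covariance (5.7)), kernel-checked
# for ANY lattice kernel carrying those printed properties (β sub-cell, row an1 gen 10, node BETA-an1-g10-ODD-MOMENTS;
# the cell's answer to the certified-numerics referee's question R-cap-24 (b))

HONEST FRAMING (cell `pub-balaban`, verbatim rule, page 1 of everything the β sub-cell writes): discharging `BetaPertH`
makes Bałaban's UV stability UNCONDITIONAL — a real constructive-QFT result; it is NOT the continuum limit and NOT the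
Clay problem.  THIS MODULE DISCHARGES NOTHING of the series and asserts NOTHING about Bałaban's polarization tensor
`Π_{j+1,μν}`: exactly as in the host module `Beta.PolarizationSign` (row an2 / pv09), every printed property enters as a
PREDICATE on an abstract kernel `P : B12Beta.Kernel d` (`WardTransversal`, `AxisReflectionCovariant`, `IndexSymmetric`,
`MomentSummable` — reused BY NAME, not restated) and is used only as a HYPOTHESIS; the conclusions are `[folklore]`
re-indexing / summation-by-parts identities on `ℤ^d`.  ABSOLUTE RULE respected: no internally-minted statement is cited
as a fact; the certified-numerics lanes' engines (cap1/cap2) are NOT audited here — this file only settles which of their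
symmetry checks are theorems of the OBJECT.  Value = kernel certificate of an elementary structural fact + a precise
dictionary for the numerics referee, NOT summit progress.

CITATION HEADER (lean-in-tree rule 2026-08-18; CONTEXT ONLY).  T. Bałaban, *Renormalization group approach to lattice
gauge field theories. I. Generation of effective actions in a small field approximation and a coupling constant
renormalization in four dimensions*, Commun. Math. Phys. **109**, 249–301 (1987) [Balaban1987RG1] (cell paper B12; held
`paper:balaban1987-cmp109-rg-i-small-field`; journal page = PDF page + 248).  The four printed properties of the scale-`j`
polarization kernel on p. 293 — (5.7) reflection covariance «Π_{μν}(εx − ((1−ε_μ)/2)e_μ, εy − ((1−ε_ν)/2)e_ν) =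
ε_μ ε_ν Π_{μν}(x, y)», (5.8) «Π_{μν}(x, y) = Π_{μν}(x − y), Π_{μν}(x) = Π_{νμ}(−x)», (5.9) «Σ_μ ∂*_μ Π_{μν}(x − y) =
Σ_ν ∂_ν Π_{μν}(x − y) = 0» (gauge invariance, (4.15)), (5.10) exponential decay — are quoted and typed in
`Beta.PolarizationSign` (its citation header; renders p045-x2); p. 264 (1.20)–(1.22) (`B12Beta`): the one-loop coefficient is
the mixed SECOND moment `β_{j+1} = Σ_x Π_{j+1,μν}(x) x_μ x_ν = −(∂²/∂p₁∂p₂)Π̃_{j+1,12}(0)`, (5.11) «Π_{μν}(p) = Σ_x e^{−ip·x}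
Π_{μν}(x)».  Nothing else of the paper is used; nothing of it is asserted.

THE QUESTION (cell records: certified-numerics referee REPORT #8, `HOME/b2b-balaban-beta-cap-ref/REFEREE-beta-cap.md`
§44–§48, R-cap-24; lead BETA-SPEC v1.9zx §7.35 (e)).  Two code-disjoint engines evaluate the one-loop form factor of the
(0.4)/(1.22) object over the truncated ring `𝔽[p₁,p₂]/(p₁²,p₂²)` («p-jet», CAP-KERNEL.md (S3)): with sources of
polarisation `1` (momentum `+p`) and `2` (momentum `−p`) the `st`-part is `F(p) = Σ_z Π_{12}(z) e^{ip·z}`, so its ring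
components are `[st·1] = Σ_z Π_{12}(z)` (ZEROTH MOMENT), `[st·p_α] = i·Σ_z z_α Π_{12}(z)`, `α ∈ {1,2}` (FIRST MOMENTS —
the «parity-odd components»), `[st·p₁p₂] = −Σ_z z₁z₂ Π_{12}(z) = −β`.  Both engines find the odd components `= 0` for
`U(1)` and `≠ 0` (purely imaginary, e.g. `±4.26·10⁻³ i`) for `SU(2)`; R-cap-24 (b) asks the derivation owners whether
«`[st p_μ] = 0`» is a THEOREM of the object («which Ward identity») or a heuristic.

THE ANSWER, KERNEL HALF (this file; the located prose half is `HOME/BETA/AN1.md` §24).  THEOREM — by two INDEPENDENT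
printed routes, for every kernel `P : B12Beta.Kernel d` (any `d`, any gauge group: colour enters only through (1.21)):
* §1 REFLECTION ROUTE — (5.7)+(5.8) ALONE, no Ward identity, no summability (pure re-indexing by the bijections
  `z ↦ εz`, `z ↦ εz ∓ e_α` of `ℤ^d`): `firstMoment_eq_zero_of_reflectionCovariant` — EVERY first moment
  `Σ_z P_{μν}(z) z_γ` of EVERY channel vanishes (`μ, ν, γ` arbitrary); `zerothMoment_eq_zero_of_reflectionCovariant` — the
  zeroth moment of every OFF-diagonal channel vanishes.  Mechanism: reflecting the axis of the LEFT index flips the sign of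
  `P_{μν}` (`μ ≠ ν`) and preserves `z_γ` for `γ ≠ μ`; reflecting the axis of the RIGHT index does the same for `γ ≠ ν`;
  reflecting an axis carried by both or neither index preserves `P_{μν}` and flips `z_γ` for `γ` = that axis.  (The host's
  `PolarizationSign.first_moment_eq_zero` is the instance `γ = ν`, `μ ≠ ν`.)
* §2 WARD ROUTE — (5.9)+(5.8) + summable moments, no reflections (summation by parts = the host's `ward_pairing` tested
  against the quadratic weights `z_α²` and `z_α z_β`): `firstMoment_left_eq_zero_of_ward` — `Σ_z P_{μν}(z) z_μ = 0` (the
  first moment ALONG THE LEFT INDEX); `firstMoment_right_eq_zero_of_ward` — `Σ_z P_{μν}(z) z_ν = 0` (along the right index,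
  via (5.8)); `firstMoment_ward_antisymm` — for `α ≠ β`, `Σ_z P_{αν}(z) z_β = −Σ_z P_{βν}(z) z_α`: the Ward identity leaves
  exactly a residue antisymmetric under (weight direction ↔ left index) — for `d ≥ 3` the OUT-OF-PLANE odd moments
  `Σ_z P_{12}(z) z_γ`, `γ ∉ {1,2}`, are NOT killed by gauge invariance alone (they are by §1).  Zeroth moments:
  the host's `tsum_eq_zero_of_ward`.
* §3 THE RING DICTIONARY — `oddJet_eq_zero_of_ward` / `oddJet_eq_zero_of_reflectionCovariant`: the three parity-odd ring
  components of the `(μ,ν)` channel in the `(p_μ,p_ν)` plane, `(Σ_z P_{μν}(z), Σ_z P_{μν}(z) z_μ, Σ_z P_{μν}(z) z_ν)`, are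
  `(0,0,0)` under EITHER route; and, for a FINITELY supported (complex) kernel, `hasDerivAt_lineSymbol_zero`: the derivative
  at `t = 0` of `t ↦ Σ_{z∈S} c(z) e^{i t ⟨v,z⟩}` is `i·Σ_{z∈S} c(z)⟨v,z⟩` — the `[p_γ]` ring coefficient IS `i ×` the first
  moment along `e_γ` (the infinite-support version under `MomentSummable` is the host lane's `Beta.MomentSymbol` technique and
  is not repeated).

WHAT THIS SAYS ABOUT THE ENGINES' OBJECT (recorded in AN1.md §24; NOT formalised — it concerns the numerics lanes' grid
regularisation, not a printed object).  The engines' `F_n(p)` puts the loop momentum on the `(2π/n)ℤ⁴` grid and treats `p`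
formally (off-grid).  (i) The WARD route does NOT transfer to `F_n`: background gauge invariance of the `n`-periodic
fluctuation integral holds for `n`-periodic gauge parameters only, so `WardTransversal` of the grid object can fail off-grid by
an aliasing-size amount (→ 0 as `n → ∞`, where (5.9) holds).  (ii) The REFLECTION route DOES transfer whenever the engine's
construction is axis-reflection covariant about a block centre (`L` odd with centred blocks — the printed parity/centring,
p. 251 «L is an odd, positive integer >11», p. 252 (0.3); the argument uses only oddness + centring, print moreover takes
`L > 11` — and reflection-symmetric cell/representative conventions): §1 then gives
`[st·1] = [st p₁] = [st p₂] = 0` EXACTLY at every `n`, so a nonzero `SU(2)` odd component at `L = 3` detects a reflection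
NON-covariance of that sector's conventions (or a defect), whereas at `L = 2` («corner proxy», not a printed scheme) nonzero
odd components are expected and are informative only if they fail to decay in `n`.  (iii) `U(1)` being clean is STRUCTURAL:
with no charged mode the background momentum never enters a loop propagator, `F_n = F_∞`, and §2 applies exactly — it is not
evidence about the non-abelian bubble code path.  (iv) On a finite TORUS with symmetric representatives neither route is exact
for an off-diagonal channel (constant modes are not pure gauge; the shift `∓e_α` of (5.7) leaves the representative box):
torus odd moments of `Π_{12}` are exponentially small, not zero; the diagonal-channel and out-of-plane statements of §1 with no
shift survive exactly.

NOT CLAIMED: anything about Bałaban's `Π` (the predicates are hypotheses); any value or sign of `β`; any audit of the engines'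
code; anything about the wall's binders (D1)/(D4)/(D5), about `k`-uniformity or about `BetaPertH`.  Companion prose:
`HOME/BETA/AN1.md` v1.22 §24; journal CLAIM BETA-an1-g10-ODD-MOMENTS 2026-08-19T09:22:14Z; GAPS C-an1-43.
-/

namespace Literature.MathematicalPhysics.QuantumFieldTheory.Balaban1983to89.Beta.OddMoments

open Literature.MathematicalPhysics.QuantumFieldTheory.Balaban1983to89
open Literature.MathematicalPhysics.QuantumFieldTheory.Balaban1983to89.Beta.PolarizationSign
open Literature.MathematicalPhysics.QuantumFieldTheory.Balaban1983to89.B6BondElimination (unitVec unitVec_apply)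
open Finset
open scoped BigOperators

attribute [local simp]
  Literature.MathematicalPhysics.QuantumFieldTheory.Balaban1983to89.B6BondElimination.unitVec_apply

variable {d : ℕ}

/-! ## §0 The moments in question -/

/-- The ZEROTH moment of the channel `(μ, ν)`: `Σ_z P_{μν}(z)` — the `[st·1]` ring component of the engines' form
factor for `(μ, ν) = (1, 2)` (as a `∑'`; `0` by convention if not summable). [cite: Balaban1987RG1, (5.11) p.293] -/
noncomputable def zerothMoment (P : B12Beta.Kernel d) (μ ν : Fin d) : ℝ := ∑' z, P μ ν z

/-- The FIRST moment of the channel `(μ, ν)` along the lattice direction `γ`: `Σ_z P_{μν}(z) z_γ` — `(−i)×` the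
`[st·p_γ]` ring component («parity-odd component») of the engines' form factor `Σ_z Π_{12}(z) e^{ip·z}`.
[cite: Balaban1987RG1, (1.22) p.264] -/
noncomputable def firstMoment (P : B12Beta.Kernel d) (μ ν γ : Fin d) : ℝ := ∑' z, P μ ν z * (z γ : ℝ)

/-- The host module's `first_moment_eq_zero` is the instance `γ = ν` (`μ ≠ ν`) of §1 below. [folklore] -/
example {P : B12Beta.Kernel d} (hR : AxisReflectionCovariant P) {μ ν : Fin d} (hμν : μ ≠ ν) :
    firstMoment P μ ν ν = 0 := first_moment_eq_zero hR hμν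

/-! ## §1 The REFLECTION route: (5.7)–(5.8) alone kill every first moment (no Ward identity, no summability) -/

/-- Reflection of an axis `α` carried by BOTH indices or by NEITHER (`μ = α ↔ ν = α`): (5.7) reads
`P_{μν}(εz) = P_{μν}(z)` (sign `ε_με_ν = +1`, no shift), and `z ↦ εz` flips `z_α`; hence `Σ_z P_{μν}(z) z_α = 0`.
[folklore] -/
theorem firstMoment_eq_zero_of_refl_even {P : B12Beta.Kernel d} (hR : AxisReflectionCovariant P)
    {α μ ν : Fin d} (h : μ = α ↔ ν = α) : firstMoment P μ ν α = 0 := by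
  unfold firstMoment
  -- the involution `z ↦ εz`
  let φ : (Fin d → ℤ) ≃ (Fin d → ℤ) :=
    { toFun := axisReflect α, invFun := axisReflect α,
      left_inv := axisReflect_axisReflect α, right_inv := axisReflect_axisReflect α }
  have hP : ∀ z, P μ ν (φ z) = P μ ν z := by
    intro z
    show P μ ν (axisReflect α z) = P μ ν z
    by_cases hμ : μ = α
    · have hν : ν = α := h.mp hμ
      rw [hμ, hν]
      have h0 := hR α α α z
      simp [reflSign] at h0
      exact h0
    · have hν : ¬ ν = α := fun hν => hμ (h.mpr hν)
      have h0 := hR α μ ν z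
      simp [reflSign, hμ, hν] at h0
      exact h0
  have hφα : ∀ z, (((φ z) α : ℤ) : ℝ) = -(z α : ℝ) := by
    intro z
    show ((axisReflect α z α : ℤ) : ℝ) = -(z α : ℝ)
    simp
  have hsum := φ.tsum_eq (fun w => P μ ν w * (w α : ℝ))
  simp only [hP, hφα] at hsum
  have h' : ∑' z, P μ ν z * -(z α : ℝ) = -∑' z, P μ ν z * (z α : ℝ) := by
    rw [← tsum_neg]; exact tsum_congr fun z => by ring
  linarith

/-- Reflection of the axis of the LEFT index (`μ ≠ ν`): (5.7) reads `P_{μν}(εz − e_μ) = −P_{μν}(z)`, and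
`z ↦ εz − e_μ` preserves `z_γ` for `γ ≠ μ`; hence `Σ_z P_{μν}(z) z_γ = 0` for every `γ ≠ μ`. [folklore] -/
theorem firstMoment_eq_zero_of_refl_left {P : B12Beta.Kernel d} (hR : AxisReflectionCovariant P)
    {μ ν γ : Fin d} (hμν : μ ≠ ν) (hγ : γ ≠ μ) : firstMoment P μ ν γ = 0 := by
  unfold firstMoment
  let φ : (Fin d → ℤ) ≃ (Fin d → ℤ) :=
    { toFun := fun z => axisReflect μ z - unitVec μ
      invFun := fun w => axisReflect μ (w + unitVec μ)
      left_inv := fun z => by simp only [sub_add_cancel, axisReflect_axisReflect]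
      right_inv := fun w => by simp only [axisReflect_axisReflect, add_sub_cancel_right] }
  have hP : ∀ z, P μ ν (φ z) = -P μ ν z := by
    intro z
    have h0 := hR μ μ ν z
    simp [reflSign, hμν.symm] at h0
    have e : φ z = axisReflect μ z - unitVec μ := rfl
    rw [e]; linarith
  have hφγ : ∀ z, (((φ z) γ : ℤ) : ℝ) = (z γ : ℝ) := by
    intro z
    have e : φ z = axisReflect μ z - unitVec μ := rfl
    rw [e]
    simp [hγ]
  have hsum := φ.tsum_eq (fun w => P μ ν w * (w γ : ℝ))
  simp only [hP, hφγ] at hsum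
  have h' : ∑' z, -P μ ν z * (z γ : ℝ) = -∑' z, P μ ν z * (z γ : ℝ) := by
    rw [← tsum_neg]; exact tsum_congr fun z => by ring
  linarith

/-- Reflection of the axis of the RIGHT index (`μ ≠ ν`): (5.7) reads `P_{μν}(εz + e_ν) = −P_{μν}(z)`, and
`z ↦ εz + e_ν` preserves `z_γ` for `γ ≠ ν`; hence `Σ_z P_{μν}(z) z_γ = 0` for every `γ ≠ ν`. [folklore] -/
theorem firstMoment_eq_zero_of_refl_right {P : B12Beta.Kernel d} (hR : AxisReflectionCovariant P)
    {μ ν γ : Fin d} (hμν : μ ≠ ν) (hγ : γ ≠ ν) : firstMoment P μ ν γ = 0 := by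
  unfold firstMoment
  let φ : (Fin d → ℤ) ≃ (Fin d → ℤ) :=
    { toFun := fun z => axisReflect ν z + unitVec ν
      invFun := fun w => axisReflect ν (w - unitVec ν)
      left_inv := fun z => by simp only [add_sub_cancel_right, axisReflect_axisReflect]
      right_inv := fun w => by simp only [axisReflect_axisReflect, sub_add_cancel] }
  have hP : ∀ z, P μ ν (φ z) = -P μ ν z := by
    intro z
    have h0 := hR ν μ ν z
    simp [reflSign, hμν] at h0
    have e : φ z = axisReflect ν z + unitVec ν := rfl
    rw [e]; linarith
  have hφγ : ∀ z, (((φ z) γ : ℤ) : ℝ) = (z γ : ℝ) := by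
    intro z
    have e : φ z = axisReflect ν z + unitVec ν := rfl
    rw [e]
    simp [hγ]
  have hsum := φ.tsum_eq (fun w => P μ ν w * (w γ : ℝ))
  simp only [hP, hφγ] at hsum
  have h' : ∑' z, -P μ ν z * (z γ : ℝ) = -∑' z, P μ ν z * (z γ : ℝ) := by
    rw [← tsum_neg]; exact tsum_congr fun z => by ring
  linarith

/-- THE REFLECTION ROUTE: under the printed reflection covariance (5.7)–(5.8) ALONE, EVERY first moment of EVERY
channel vanishes — `Σ_z P_{μν}(z) z_γ = 0` for all `μ, ν, γ`.  No Ward identity, no summability.  For `μ ≠ ν` the axes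
of the two indices are reflected (left kills `γ ≠ μ`, right kills `γ ≠ ν`); for `μ = ν` the axis `γ` itself is.
[folklore] -/
theorem firstMoment_eq_zero_of_reflectionCovariant {P : B12Beta.Kernel d} (hR : AxisReflectionCovariant P)
    (μ ν γ : Fin d) : firstMoment P μ ν γ = 0 := by
  by_cases hμν : μ = ν
  · subst hμν
    exact firstMoment_eq_zero_of_refl_even hR (α := γ) Iff.rfl
  · by_cases hγ : γ = μ
    · subst hγ
      exact firstMoment_eq_zero_of_refl_right hR hμν hμν
    · exact firstMoment_eq_zero_of_refl_left hR hμν hγ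

/-- The reflection route also kills the ZEROTH moment of every OFF-diagonal channel: `Σ_z P_{μν}(z) = 0` for
`μ ≠ ν` (reflect the axis of the left index: `P_{μν}(εz − e_μ) = −P_{μν}(z)`).  No Ward identity, no summability.
[folklore] -/
theorem zerothMoment_eq_zero_of_reflectionCovariant {P : B12Beta.Kernel d} (hR : AxisReflectionCovariant P)
    {μ ν : Fin d} (hμν : μ ≠ ν) : zerothMoment P μ ν = 0 := by
  unfold zerothMoment
  let φ : (Fin d → ℤ) ≃ (Fin d → ℤ) :=
    { toFun := fun z => axisReflect μ z - unitVec μ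
      invFun := fun w => axisReflect μ (w + unitVec μ)
      left_inv := fun z => by simp only [sub_add_cancel, axisReflect_axisReflect]
      right_inv := fun w => by simp only [axisReflect_axisReflect, add_sub_cancel_right] }
  have hP : ∀ z, P μ ν (φ z) = -P μ ν z := by
    intro z
    have h0 := hR μ μ ν z
    simp [reflSign, hμν.symm] at h0
    have e : φ z = axisReflect μ z - unitVec μ := rfl
    rw [e]; linarith
  have hsum := φ.tsum_eq (fun w => P μ ν w)
  simp only [hP, tsum_neg] at hsum
  linarith

/-! ## §2 The WARD route: (5.9) + (5.8) + summable moments kill the zeroth and the IN-PLANE first moments -/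

/-- Summability bookkeeping: the linear weight `z_α` pairs summably with `P` under `MomentSummable P 3`.
[folklore] -/
theorem summable_mul_coord {P : B12Beta.Kernel d} (hP : MomentSummable P 3) (μ ν α : Fin d) :
    Summable fun z => P μ ν z * (z α : ℝ) :=
  hP.summable_mul μ ν 1 fun z => by
    rw [one_mul]; exact (abs_apply_le_size z α).trans (size_le_pow z (by norm_num))

/-- Summability bookkeeping: the quadratic weight `z_α z_β`. [folklore] -/
theorem summable_mul_coord_mul_coord {P : B12Beta.Kernel d} (hP : MomentSummable P 3) (μ ν α β : Fin d) :
    Summable fun z => P μ ν z * ((z α : ℝ) * (z β : ℝ)) :=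
  hP.summable_mul μ ν 1 fun z => by
    rw [abs_mul, one_mul, pow_succ, pow_two]
    refine mul_le_mul ?_ (abs_apply_le_size z β) (abs_nonneg _)
      (mul_nonneg (size_pos z).le (size_pos z).le)
    exact (abs_apply_le_size z α).trans (by nlinarith [one_le_size z])

/-- Summability bookkeeping: the shifted quadratic weight `(z + e_κ)_α (z + e_κ)_β`. [folklore] -/
theorem summable_mul_shift_coord_mul_coord {P : B12Beta.Kernel d} (hP : MomentSummable P 3)
    (μ ν α β κ : Fin d) :
    Summable fun z => P μ ν z * ((((z + unitVec κ) α : ℤ) : ℝ) * (((z + unitVec κ) β : ℤ) : ℝ)) :=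
  hP.summable_mul μ ν 4 fun z => by
    rw [abs_mul]
    calc |(((z + unitVec κ) α : ℤ) : ℝ)| * |(((z + unitVec κ) β : ℤ) : ℝ)|
        ≤ size (z + unitVec κ) * size (z + unitVec κ) :=
          mul_le_mul (abs_apply_le_size _ α) (abs_apply_le_size _ β) (abs_nonneg _) (size_pos _).le
      _ ≤ (2 * size z) * (2 * size z) :=
          mul_le_mul (size_add_unitVec_le z κ) (size_add_unitVec_le z κ) (size_pos _).le
            (by linarith [size_pos z])
      _ = 4 * size z ^ 2 := by ring
      _ ≤ 4 * size z ^ 3 := by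
          have := pow_le_pow_right₀ (one_le_size z) (show 2 ≤ 3 by norm_num)
          linarith

/-- Summability bookkeeping: `P_{μν}` itself is summable under `MomentSummable P 3`. [folklore] -/
theorem summable_self {P : B12Beta.Kernel d} (hP : MomentSummable P 3) (μ ν : Fin d) :
    Summable fun z => P μ ν z := by
  have h := hP.summable_mul μ ν 1 (w := fun _ => (1 : ℝ)) fun z => by
    rw [abs_one, one_mul]; exact one_le_pow₀ (one_le_size z)
  simpa using h

/-- Pulling a Kronecker delta out of a `∑'`. [folklore] -/
theorem tsum_mul_ite (P : B12Beta.Kernel d) (μ ν α : Fin d) (w : (Fin d → ℤ) → ℝ) :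
    ∑' z, P μ ν z * (if μ = α then w z else 0) = if μ = α then ∑' z, P μ ν z * w z else 0 := by
  split_ifs <;> simp

/-- THE SQUARE-WEIGHT WARD IDENTITY: testing (5.9) against `g(z) = z_α²` (`g(z + e_μ) − g(z) = δ_{μα}(2z_α + 1)`)
gives `2 Σ_z P_{αν}(z) z_α + Σ_z P_{αν}(z) = 0`. [folklore] -/
theorem ward_square_identity {P : B12Beta.Kernel d} (hP : MomentSummable P 3) (hT : WardTransversal P)
    (α ν : Fin d) : 2 * firstMoment P α ν α + zerothMoment P α ν = 0 := by
  let g : (Fin d → ℤ) → ℝ := fun z => (z α : ℝ) * (z α : ℝ)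
  have h0 : ∀ μ, Summable fun z => P μ ν z * g z := fun μ => summable_mul_coord_mul_coord hP μ ν α α
  have h1 : ∀ μ, Summable fun z => P μ ν z * g (z + unitVec μ) := fun μ =>
    summable_mul_shift_coord_mul_coord hP μ ν α α μ
  have key := ward_pairing P hT ν g h0 h1
  have hdiff : ∀ μ z, g (z + unitVec μ) - g z = if μ = α then 2 * (z α : ℝ) + 1 else 0 := by
    intro μ z
    by_cases h : μ = α
    · subst h; simp [g]; ring
    · simp [g, h, Ne.symm h]
  simp_rw [hdiff, tsum_mul_ite] at key
  rw [Finset.sum_ite_eq'] at key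
  simp only [Finset.mem_univ, if_true] at key
  have hsplit : ∑' z, P α ν z * (2 * (z α : ℝ) + 1) = 2 * firstMoment P α ν α + zerothMoment P α ν := by
    unfold firstMoment zerothMoment
    rw [← tsum_mul_left, ← Summable.tsum_add ((summable_mul_coord hP α ν α).mul_left 2)
      (summable_self hP α ν)]
    exact tsum_congr fun z => by ring
  linarith [hsplit]

/-- THE BILINEAR-WEIGHT WARD IDENTITY: testing (5.9) against `g(z) = z_α z_β`, `α ≠ β`
(`g(z + e_μ) − g(z) = δ_{μα} z_β + δ_{μβ} z_α`) gives `Σ_z P_{αν}(z) z_β + Σ_z P_{βν}(z) z_α = 0`. [folklore] -/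
theorem ward_bilinear_identity {P : B12Beta.Kernel d} (hP : MomentSummable P 3) (hT : WardTransversal P)
    {α β : Fin d} (hαβ : α ≠ β) (ν : Fin d) : firstMoment P α ν β + firstMoment P β ν α = 0 := by
  let g : (Fin d → ℤ) → ℝ := fun z => (z α : ℝ) * (z β : ℝ)
  have h0 : ∀ μ, Summable fun z => P μ ν z * g z := fun μ => summable_mul_coord_mul_coord hP μ ν α β
  have h1 : ∀ μ, Summable fun z => P μ ν z * g (z + unitVec μ) := fun μ =>
    summable_mul_shift_coord_mul_coord hP μ ν α β μ
  have key := ward_pairing P hT ν g h0 h1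
  have hdiff : ∀ μ z, g (z + unitVec μ) - g z
      = (if μ = α then (z β : ℝ) else 0) + (if μ = β then (z α : ℝ) else 0) := by
    intro μ z
    by_cases ha : μ = α
    · subst ha; simp [g, hαβ, hαβ.symm]; ring
    · by_cases hb : μ = β
      · subst hb; simp [g, ha, Ne.symm ha]; ring
      · simp [g, ha, hb, Ne.symm ha, Ne.symm hb]
  simp_rw [hdiff, mul_add] at key
  have sA : ∀ μ, Summable fun z => P μ ν z * (if μ = α then (z β : ℝ) else 0) := by
    intro μ; by_cases h : μ = α
    · simp only [h, if_true]; exact summable_mul_coord hP α ν β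
    · simp only [h, if_false, mul_zero]; exact summable_zero
  have sB : ∀ μ, Summable fun z => P μ ν z * (if μ = β then (z α : ℝ) else 0) := by
    intro μ; by_cases h : μ = β
    · simp only [h, if_true]; exact summable_mul_coord hP β ν α
    · simp only [h, if_false, mul_zero]; exact summable_zero
  have hsplit : ∀ μ, ∑' z, (P μ ν z * (if μ = α then (z β : ℝ) else 0)
      + P μ ν z * (if μ = β then (z α : ℝ) else 0))
      = (if μ = α then ∑' z, P μ ν z * (z β : ℝ) else 0)
        + (if μ = β then ∑' z, P μ ν z * (z α : ℝ) else 0) := by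
    intro μ
    rw [Summable.tsum_add (sA μ) (sB μ), tsum_mul_ite, tsum_mul_ite]
  simp_rw [hsplit] at key
  rw [Finset.sum_add_distrib, Finset.sum_ite_eq', Finset.sum_ite_eq'] at key
  simp only [Finset.mem_univ, if_true] at key
  unfold firstMoment
  linarith

/-- THE WARD ROUTE, LEFT INDEX: under (5.9) + summable moments the first moment of `P_{μν}` ALONG ITS LEFT INDEX
vanishes, `Σ_z P_{μν}(z) z_μ = 0` (square-weight identity + vanishing zeroth moment, the host's `tsum_eq_zero_of_ward`).
For the channel `(1,2)` this is the `[st·p₁]` ring component. [folklore] -/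
theorem firstMoment_left_eq_zero_of_ward {P : B12Beta.Kernel d} (hP : MomentSummable P 3)
    (hT : WardTransversal P) (μ ν : Fin d) : firstMoment P μ ν μ = 0 := by
  have h1 := ward_square_identity hP hT μ ν
  have h2 : zerothMoment P μ ν = 0 := tsum_eq_zero_of_ward hP hT μ ν
  linarith

/-- THE WARD ROUTE LEAVES AN ANTISYMMETRIC RESIDUE: for `α ≠ β`, `Σ_z P_{αν}(z) z_β = −Σ_z P_{βν}(z) z_α` — the
first moment of a channel along a direction NOT carried by its left index is determined by gauge invariance only up to
this antisymmetry (for `d ≥ 3`, the out-of-plane odd moments `Σ_z P_{12}(z) z_γ`, `γ ∉ {1,2}`, are not killed by (5.9)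
alone; §1 kills them). [folklore] -/
theorem firstMoment_ward_antisymm {P : B12Beta.Kernel d} (hP : MomentSummable P 3) (hT : WardTransversal P)
    {α β : Fin d} (hαβ : α ≠ β) (ν : Fin d) : firstMoment P α ν β = -firstMoment P β ν α := by
  linarith [ward_bilinear_identity hP hT hαβ ν]

/-- Index symmetry (5.8) `P_{μν}(z) = P_{νμ}(−z)` exchanges the roles of the indices in a first moment, with a sign:
`Σ_z P_{μν}(z) z_γ = −Σ_z P_{νμ}(z) z_γ`. [folklore] -/
theorem firstMoment_swap_of_indexSymmetric {P : B12Beta.Kernel d} (hS : IndexSymmetric P) (μ ν γ : Fin d) :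
    firstMoment P μ ν γ = -firstMoment P ν μ γ := by
  unfold firstMoment
  have hsum := (Equiv.neg (Fin d → ℤ)).tsum_eq (fun w => P ν μ w * (w γ : ℝ))
  simp only [Equiv.neg_apply, Pi.neg_apply, Int.cast_neg] at hsum
  have e : ∀ z, P μ ν z * (z γ : ℝ) = -(P ν μ (-z) * -(z γ : ℝ)) := by
    intro z; rw [hS μ ν z]; ring
  simp_rw [e, tsum_neg, hsum]

/-- THE WARD ROUTE, RIGHT INDEX: under (5.9) + (5.8) + summable moments the first moment of `P_{μν}` ALONG ITS RIGHT
INDEX vanishes, `Σ_z P_{μν}(z) z_ν = 0`.  For the channel `(1,2)` this is the `[st·p₂]` ring component. [folklore] -/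
theorem firstMoment_right_eq_zero_of_ward {P : B12Beta.Kernel d} (hP : MomentSummable P 3)
    (hT : WardTransversal P) (hS : IndexSymmetric P) (μ ν : Fin d) : firstMoment P μ ν ν = 0 := by
  rw [firstMoment_swap_of_indexSymmetric hS, firstMoment_left_eq_zero_of_ward hP hT ν μ, neg_zero]

/-! ## §3 The ring dictionary: the three parity-odd components of the `(μ,ν)` channel in the `(p_μ,p_ν)` plane -/

/-- The PARITY-ODD part of the zero-momentum jet of the channel `(μ, ν)` in the `(p_μ, p_ν)` plane, as real data:
`(Σ_z P_{μν}(z), Σ_z P_{μν}(z) z_μ, Σ_z P_{μν}(z) z_ν)` = (`[st·1]`, `−i[st·p_μ]`, `−i[st·p_ν]`) of the engines'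
form factor `Σ_z P_{μν}(z) e^{ip·z}` (CAP-KERNEL.md (S3)); the even component `[st·p_μp_ν] = −B12Beta.secondMoment`.
[cite: Balaban1987RG1, (1.22) p.264] -/
noncomputable def oddJet (P : B12Beta.Kernel d) (μ ν : Fin d) : ℝ × ℝ × ℝ :=
  (zerothMoment P μ ν, firstMoment P μ ν μ, firstMoment P μ ν ν)

/-- R-cap-24 (b), WARD ROUTE: for an off-diagonal channel the parity-odd jet vanishes under (5.9) + (5.8) + summable
moments. [folklore] -/
theorem oddJet_eq_zero_of_ward {P : B12Beta.Kernel d} (hP : MomentSummable P 3) (hT : WardTransversal P)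
    (hS : IndexSymmetric P) (μ ν : Fin d) : oddJet P μ ν = (0, 0, 0) := by
  unfold oddJet
  rw [show zerothMoment P μ ν = 0 from tsum_eq_zero_of_ward hP hT μ ν,
    firstMoment_left_eq_zero_of_ward hP hT, firstMoment_right_eq_zero_of_ward hP hT hS]

/-- R-cap-24 (b), REFLECTION ROUTE: for an off-diagonal channel (`μ ≠ ν`) the parity-odd jet vanishes under (5.7)
ALONE — no Ward identity, no summability, any `d`, any gauge group. [folklore] -/
theorem oddJet_eq_zero_of_reflectionCovariant {P : B12Beta.Kernel d} (hR : AxisReflectionCovariant P)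
    {μ ν : Fin d} (hμν : μ ≠ ν) : oddJet P μ ν = (0, 0, 0) := by
  unfold oddJet
  rw [zerothMoment_eq_zero_of_reflectionCovariant hR hμν,
    firstMoment_eq_zero_of_reflectionCovariant hR, firstMoment_eq_zero_of_reflectionCovariant hR]

/-- The integer pairing `⟨v, z⟩ = Σ_i v_i z_i`, as a real number. [folklore] -/
def pairing (v z : Fin d → ℤ) : ℝ := ∑ i, (v i : ℝ) * (z i : ℝ)

/-- `⟨e_γ, z⟩ = z_γ`. [folklore] -/
theorem pairing_unitVec (γ : Fin d) (z : Fin d → ℤ) : pairing (unitVec γ) z = (z γ : ℝ) := by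
  unfold pairing
  simp [eq_comm]

/-- The form factor of a FINITELY supported (complex) kernel `c` along the momentum line `p = t·v`:
`t ↦ Σ_{z∈S} c(z) e^{i t ⟨v,z⟩}` (the engines' `F(p)` restricted to a line; convention `e^{+ip·z}` as in CAP-KERNEL
(S3) — with (5.11)'s `e^{−ip·x}` every odd coefficient changes sign, which is immaterial for vanishing). [folklore] -/
noncomputable def lineSymbol (S : Finset (Fin d → ℤ)) (c : (Fin d → ℤ) → ℂ) (v : Fin d → ℤ) (t : ℝ) : ℂ :=
  ∑ z ∈ S, c z * Complex.exp (Complex.I * (t : ℂ) * (pairing v z : ℂ))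

/-- At `t = 0` the line symbol is the zeroth moment `Σ_{z∈S} c(z)` (`[st·1]`). [folklore] -/
theorem lineSymbol_zero (S : Finset (Fin d → ℤ)) (c : (Fin d → ℤ) → ℂ) (v : Fin d → ℤ) :
    lineSymbol S c v 0 = ∑ z ∈ S, c z := by
  unfold lineSymbol; simp

/-- Term-by-term derivative of the line symbol. [folklore] -/
theorem hasDerivAt_lineSymbol (S : Finset (Fin d → ℤ)) (c : (Fin d → ℤ) → ℂ) (v : Fin d → ℤ) (t : ℝ) :
    HasDerivAt (lineSymbol S c v)
      (∑ z ∈ S, c z * (Complex.exp (Complex.I * (t : ℂ) * (pairing v z : ℂ))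
        * (Complex.I * (pairing v z : ℂ)))) t := by
  unfold lineSymbol
  refine HasDerivAt.fun_sum fun z _ => ?_
  have h0 : HasDerivAt (fun s : ℝ => (s : ℂ)) (1 : ℂ) t := by
    simpa using (hasDerivAt_id (t : ℝ)).ofReal_comp
  have h1 : HasDerivAt (fun s : ℝ => Complex.I * (s : ℂ) * (pairing v z : ℂ))
      (Complex.I * 1 * (pairing v z : ℂ)) t := (h0.const_mul Complex.I).mul_const _
  have h2 := (Complex.hasDerivAt_exp _).comp t h1
  have h3 := h2.const_mul (c z)
  simpa [Function.comp, mul_one] using h3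

/-- THE `[p]`-COEFFICIENT IS `i ×` THE FIRST MOMENT: the derivative at `t = 0` of the line symbol along `v` is
`i · Σ_{z∈S} c(z) ⟨v, z⟩`; along `v = e_γ` this is `i · Σ_{z∈S} c(z) z_γ`.  (For infinitely supported kernels under
`MomentSummable` the same holds by dominated differentiation — the host lane's `Beta.MomentSymbol` technique, not repeated
here.) [folklore] -/
theorem hasDerivAt_lineSymbol_zero (S : Finset (Fin d → ℤ)) (c : (Fin d → ℤ) → ℂ) (v : Fin d → ℤ) :
    HasDerivAt (lineSymbol S c v) (Complex.I * ∑ z ∈ S, c z * (pairing v z : ℂ)) 0 := by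
  have h := hasDerivAt_lineSymbol S c v 0
  simp only [Complex.ofReal_zero, mul_zero, zero_mul, Complex.exp_zero, one_mul] at h
  convert h using 1
  rw [Finset.mul_sum]
  exact Finset.sum_congr rfl fun z _ => by ring

/-- The same along a lattice axis: derivative at `0` of `t ↦ Σ_{z∈S} c(z) e^{i t z_γ}` is `i · Σ_{z∈S} c(z) z_γ`.
[folklore] -/
theorem hasDerivAt_lineSymbol_unitVec_zero (S : Finset (Fin d → ℤ)) (c : (Fin d → ℤ) → ℂ) (γ : Fin d) :
    HasDerivAt (lineSymbol S c (unitVec γ)) (Complex.I * ∑ z ∈ S, c z * ((z γ : ℝ) : ℂ)) 0 := by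
  simpa [pairing_unitVec] using hasDerivAt_lineSymbol_zero S c (unitVec γ)

/-! ## §4 Non-vacuity and scope -/

/-- The hypotheses are jointly satisfiable (the zero kernel); the content of §1–§3 is the IMPLICATION structure, the
predicates being discharged for Bałaban's `Π_{j+1}` only by whoever proves (5.7)–(5.10) for the constructed object.
[folklore] -/
example : AxisReflectionCovariant (0 : B12Beta.Kernel d) ∧ WardTransversal (0 : B12Beta.Kernel d)
    ∧ IndexSymmetric (0 : B12Beta.Kernel d) ∧ MomentSummable (0 : B12Beta.Kernel d) 3 := by
  refine ⟨fun _ _ _ _ => by simp, fun _ _ => by simp, fun _ _ _ => by simp, fun _ _ => ?_⟩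
  simp only [Pi.zero_apply, abs_zero, zero_mul]
  exact summable_zero

end Literature.MathematicalPhysics.QuantumFieldTheory.Balaban1983to89.Beta.OddMoments
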